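import Mathlib

/-!
# Far-field tail bound from length regularity (tools stub `stub_tameVerticalToolsC`)

Tools for the endgame `stub_tameVerticalSubcritical` of line `zero-accretion-selection` (crux
`SkeletonEquilibrium`, thesis `FilamentSkeletonRss`, item stmt-NavierStokesRegularity-15400).
"Length regularity" of a continuous curve `X` at a point `x₁` says that the parameters whose points
lie in the ball of radius `D ≥ D₀` (`D₀ ≥ 1`) around `x₁` have Lebesgue measure `≤ C₀ D`. From it:
(1) `σ ↦ ((‖x₁ − X σ‖² + 1)^{3/2})⁻¹` is integrable on the whole line; (2) its integral over the
far field `{σ | A ≤ ‖X σ − x₁‖}` (`A ≥ D₀`) is `≤ 4 C₀ / A²`. Proof by dyadic shells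
`2ⁿA ≤ ‖X σ − x₁‖ < 2ⁿ⁺¹A`: such a shell has measure `≤ C₀ 2ⁿ⁺¹ A` and carries the integrand
`≤ (2ⁿA)⁻³`, so it contributes `≤ (2C₀/A²) 4⁻ⁿ ≤ (2C₀/A²) 2⁻ⁿ`, which sums to `4C₀/A²`. The shell
bookkeeping is adapted from the landed `…SlopeFormula.lean` (p165350, lemma `ssf_integrable_inv`).
-/

noncomputable section

open MeasureTheory Filter

namespace Summit.NavierStokesRegularity.NavierStokesRegularity.Theorems.SkeletonEquilibrium.ZeroAccretionSelection
set_option linter.dupNamespace false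

/-- The regularised kernel `((‖z‖² + 1)^{3/2})⁻¹` is nonnegative. [folklore] -/
private theorem stvc_kernel_nonneg (z : EuclideanSpace ℝ (Fin 3)) :
    0 ≤ ((‖z‖ ^ 2 + 1) ^ (3 / 2 : ℝ))⁻¹ :=
  inv_nonneg.2 (Real.rpow_nonneg (by positivity) _)

/-- The regularised kernel `((‖z‖² + 1)^{3/2})⁻¹` is at most `1`. [folklore] -/
private theorem stvc_kernel_le_one (z : EuclideanSpace ℝ (Fin 3)) :
    ((‖z‖ ^ 2 + 1) ^ (3 / 2 : ℝ))⁻¹ ≤ 1 :=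
  inv_le_one_of_one_le₀ (Real.one_le_rpow (le_add_of_nonneg_left (sq_nonneg _)) (by norm_num))

/-- Far from the origin the regularised kernel decays like the cube of the distance:
`((‖z‖² + 1)^{3/2})⁻¹ ≤ B⁻³` whenever `0 < B ≤ ‖z‖`. [folklore] -/
private theorem stvc_kernel_le_of_le {z : EuclideanSpace ℝ (Fin 3)} {B : ℝ} (hB : 0 < B)
    (hz : B ≤ ‖z‖) : ((‖z‖ ^ 2 + 1) ^ (3 / 2 : ℝ))⁻¹ ≤ (B ^ 3)⁻¹ := by
  have hz0 : 0 ≤ ‖z‖ := norm_nonneg _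
  refine inv_anti₀ (pow_pos hB 3) ?_
  calc B ^ 3 ≤ ‖z‖ ^ 3 := pow_le_pow_left₀ hB.le hz 3
    _ = (‖z‖ ^ 2) ^ (3 / 2 : ℝ) := by
        rw [← Real.rpow_natCast ‖z‖ 3, ← Real.rpow_natCast ‖z‖ 2, ← Real.rpow_mul hz0]
        norm_num
    _ ≤ (‖z‖ ^ 2 + 1) ^ (3 / 2 : ℝ) :=
        Real.rpow_le_rpow (sq_nonneg _) (le_add_of_nonneg_right zero_le_one) (by norm_num)

-- adapted from …/Theorems/FilamentSkeletonRssSkeletonEquilibriumSlopeFormula.lean (`ssf_continuous_kernel`)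
/-- Continuity in `σ` of the regularised kernel `σ ↦ ((‖z − X σ‖² + 1)^{3/2})⁻¹`. [folklore] -/
private theorem stvc_continuous_kernel {X : ℝ → EuclideanSpace ℝ (Fin 3)} (hXc : Continuous X)
    (z : EuclideanSpace ℝ (Fin 3)) :
    Continuous (fun σ : ℝ => ((‖z - X σ‖ ^ 2 + 1) ^ (3 / 2 : ℝ))⁻¹) := by
  have hpos : ∀ σ, (0 : ℝ) < ‖z - X σ‖ ^ 2 + 1 := fun σ => by positivity
  exact ((((continuous_const.sub hXc).norm.pow 2).add continuous_const).rpow_const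
    fun σ => Or.inl (hpos σ).ne').inv₀ fun σ => (Real.rpow_pos_of_pos (hpos σ) _).ne'

-- shell bookkeeping adapted from …SlopeFormula.lean (`ssf_integrable_inv`)
/-- **Far-field tail bound (Lebesgue-integral form).** If the parameters of `X` in every ball of
radius `D ≥ D₀` around `x₁` have measure `≤ C₀ D` (`D₀ ≥ 1`, `C₀ ≥ 0`), then for `A ≥ D₀`
`∫⁻_{A ≤ ‖X σ − x₁‖} ((‖x₁ − X σ‖² + 1)^{3/2})⁻¹ dσ ≤ 4 C₀ / A²`: the dyadic shell
`2ⁿA ≤ ‖X σ − x₁‖ < 2ⁿ⁺¹A` has measure `≤ C₀ 2ⁿ⁺¹ A` and carries the integrand `≤ (2ⁿA)⁻³`.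
[folklore] -/
private theorem stvc_tail_lintegral {X : ℝ → EuclideanSpace ℝ (Fin 3)}
    {x₁ : EuclideanSpace ℝ (Fin 3)} {C₀ D₀ A : ℝ} (hC₀ : 0 ≤ C₀) (hD₀ : 1 ≤ D₀) (hA : D₀ ≤ A)
    (hlen : ∀ D : ℝ, D₀ ≤ D → volume {σ : ℝ | ‖X σ - x₁‖ ≤ D} ≤ ENNReal.ofReal (C₀ * D)) :
    ∫⁻ σ in {σ : ℝ | A ≤ ‖X σ - x₁‖}, ENNReal.ofReal (((‖x₁ - X σ‖ ^ 2 + 1) ^ (3 / 2 : ℝ))⁻¹) ≤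
      ENNReal.ofReal (4 * C₀ / A ^ 2) := by
  have hApos : 0 < A := one_pos.trans_le (hD₀.trans hA)
  have hA0 : A ≠ 0 := hApos.ne'
  -- the dyadic shells
  set S : ℕ → Set ℝ := fun n => {σ | 2 ^ n * A ≤ ‖X σ - x₁‖ ∧ ‖X σ - x₁‖ < 2 ^ (n + 1) * A}
    with hS
  have hcover : {σ : ℝ | A ≤ ‖X σ - x₁‖} ⊆ ⋃ n, S n := by
    intro σ hσ
    obtain ⟨n, hn1, hn2⟩ := exists_nat_pow_near ((one_le_div hApos).mpr hσ) one_lt_two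
    exact Set.mem_iUnion.mpr ⟨n, (le_div_iff₀ hApos).mp hn1, (div_lt_iff₀ hApos).mp hn2⟩
  -- one shell
  have hS_int : ∀ n : ℕ,
      ∫⁻ σ in S n, ENNReal.ofReal (((‖x₁ - X σ‖ ^ 2 + 1) ^ (3 / 2 : ℝ))⁻¹) ≤
        ENNReal.ofReal (2 * C₀ / A ^ 2 * ((1 : ℝ) / 2) ^ n) := by
    intro n
    have h2n : (0 : ℝ) < 2 ^ n := by positivity
    have hBpos : 0 < 2 ^ n * A := mul_pos h2n hApos
    have hle : D₀ ≤ 2 ^ (n + 1) * A :=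
      hA.trans (le_mul_of_one_le_left hApos.le (one_le_pow₀ (by norm_num)))
    calc ∫⁻ σ in S n, ENNReal.ofReal (((‖x₁ - X σ‖ ^ 2 + 1) ^ (3 / 2 : ℝ))⁻¹)
        ≤ ∫⁻ _ in S n, ENNReal.ofReal (((2 ^ n * A) ^ 3)⁻¹) := by
          refine setLIntegral_mono measurable_const fun σ hσ => ENNReal.ofReal_le_ofReal ?_
          have h1 : 2 ^ n * A ≤ ‖x₁ - X σ‖ := by
            rw [norm_sub_rev]
            exact hσ.1
          exact stvc_kernel_le_of_le hBpos h1
      _ = ENNReal.ofReal (((2 ^ n * A) ^ 3)⁻¹) * volume (S n) := setLIntegral_const _ _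
      _ ≤ ENNReal.ofReal (((2 ^ n * A) ^ 3)⁻¹) * ENNReal.ofReal (C₀ * (2 ^ (n + 1) * A)) := by
          gcongr
          exact (measure_mono fun σ hσ => hσ.2.le).trans (hlen _ hle)
      _ = ENNReal.ofReal (((2 ^ n * A) ^ 3)⁻¹ * (C₀ * (2 ^ (n + 1) * A))) :=
          (ENNReal.ofReal_mul (by positivity)).symm
      _ ≤ ENNReal.ofReal (2 * C₀ / A ^ 2 * ((1 : ℝ) / 2) ^ n) := by
          refine ENNReal.ofReal_le_ofReal ?_
          have heq : (((2 : ℝ) ^ n * A) ^ 3)⁻¹ * (C₀ * (2 ^ (n + 1) * A)) =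
              2 * C₀ / A ^ 2 * ((1 : ℝ) / 2) ^ n * (2 ^ n)⁻¹ := by
            rw [one_div, inv_pow]
            field_simp
            ring
          rw [heq]
          exact mul_le_of_le_one_right (by positivity)
            (inv_le_one_of_one_le₀ (one_le_pow₀ (by norm_num)))
  -- summing the shells
  have hsum : Summable fun n : ℕ => 2 * C₀ / A ^ 2 * ((1 : ℝ) / 2) ^ n :=
    summable_geometric_two.mul_left _
  calc ∫⁻ σ in {σ : ℝ | A ≤ ‖X σ - x₁‖}, ENNReal.ofReal (((‖x₁ - X σ‖ ^ 2 + 1) ^ (3 / 2 : ℝ))⁻¹)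
      ≤ ∫⁻ σ in ⋃ n, S n, ENNReal.ofReal (((‖x₁ - X σ‖ ^ 2 + 1) ^ (3 / 2 : ℝ))⁻¹) :=
        lintegral_mono_set hcover
    _ ≤ ∑' n, ∫⁻ σ in S n, ENNReal.ofReal (((‖x₁ - X σ‖ ^ 2 + 1) ^ (3 / 2 : ℝ))⁻¹) :=
        lintegral_iUnion_le _ _
    _ ≤ ∑' n : ℕ, ENNReal.ofReal (2 * C₀ / A ^ 2 * ((1 : ℝ) / 2) ^ n) :=
        ENNReal.tsum_le_tsum hS_int
    _ = ENNReal.ofReal (∑' n : ℕ, 2 * C₀ / A ^ 2 * ((1 : ℝ) / 2) ^ n) :=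
        (ENNReal.ofReal_tsum_of_nonneg (fun n => by positivity) hsum).symm
    _ = ENNReal.ofReal (4 * C₀ / A ^ 2) := by
        rw [tsum_mul_left, tsum_geometric_two]
        congr 1
        ring

/-- **Integrability from length regularity.** If a continuous curve `X` spends measure `≤ C₀ D`
in every ball of radius `D ≥ D₀` around `x₁` (`D₀ ≥ 1`, `C₀ ≥ 0`), then
`σ ↦ ((‖x₁ − X σ‖² + 1)^{3/2})⁻¹` is integrable: the near field `‖X σ − x₁‖ < D₀` has measure
`≤ C₀ D₀` and carries the integrand `≤ 1`, the far field is handled by `stvc_tail_lintegral`.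
[folklore] -/
private theorem stvc_integrable {X : ℝ → EuclideanSpace ℝ (Fin 3)} (hXc : Continuous X)
    (x₁ : EuclideanSpace ℝ (Fin 3)) {C₀ D₀ : ℝ} (hC₀ : 0 ≤ C₀) (hD₀ : 1 ≤ D₀)
    (hlen : ∀ D : ℝ, D₀ ≤ D → volume {σ : ℝ | ‖X σ - x₁‖ ≤ D} ≤ ENNReal.ofReal (C₀ * D)) :
    Integrable (fun σ : ℝ => ((‖x₁ - X σ‖ ^ 2 + 1) ^ (3 / 2 : ℝ))⁻¹) := by
  have hnn : ∀ σ, 0 ≤ ((‖x₁ - X σ‖ ^ 2 + 1) ^ (3 / 2 : ℝ))⁻¹ := fun σ => stvc_kernel_nonneg _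
  refine ⟨(stvc_continuous_kernel hXc x₁).aestronglyMeasurable,
    (hasFiniteIntegral_iff_ofReal (Eventually.of_forall hnn)).2 ?_⟩
  set S₀ : Set ℝ := {σ | ‖X σ - x₁‖ < D₀} with hS₀
  set T : Set ℝ := {σ | D₀ ≤ ‖X σ - x₁‖} with hT
  have hcover : S₀ ∪ T = Set.univ := by
    refine Set.eq_univ_of_forall fun σ => ?_
    rcases lt_or_ge ‖X σ - x₁‖ D₀ with h | h
    · exact Or.inl h
    · exact Or.inr h
  -- the near field
  have h0 : ∫⁻ σ in S₀, ENNReal.ofReal (((‖x₁ - X σ‖ ^ 2 + 1) ^ (3 / 2 : ℝ))⁻¹) ≤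
      ENNReal.ofReal (C₀ * D₀) := by
    calc ∫⁻ σ in S₀, ENNReal.ofReal (((‖x₁ - X σ‖ ^ 2 + 1) ^ (3 / 2 : ℝ))⁻¹)
        ≤ ∫⁻ _ in S₀, 1 :=
          lintegral_mono fun σ => ENNReal.ofReal_le_one.2 (stvc_kernel_le_one _)
      _ = volume S₀ := setLIntegral_one _
      _ ≤ volume {σ : ℝ | ‖X σ - x₁‖ ≤ D₀} :=
          measure_mono fun σ hσ => show ‖X σ - x₁‖ ≤ D₀ from le_of_lt (show ‖X σ - x₁‖ < D₀ from hσ)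
      _ ≤ ENNReal.ofReal (C₀ * D₀) := hlen D₀ le_rfl
  -- the far field
  have h1 : ∫⁻ σ in T, ENNReal.ofReal (((‖x₁ - X σ‖ ^ 2 + 1) ^ (3 / 2 : ℝ))⁻¹) ≤
      ENNReal.ofReal (4 * C₀ / D₀ ^ 2) := stvc_tail_lintegral hC₀ hD₀ le_rfl hlen
  calc ∫⁻ σ, ENNReal.ofReal (((‖x₁ - X σ‖ ^ 2 + 1) ^ (3 / 2 : ℝ))⁻¹)
      = ∫⁻ σ in S₀ ∪ T, ENNReal.ofReal (((‖x₁ - X σ‖ ^ 2 + 1) ^ (3 / 2 : ℝ))⁻¹) := by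
        rw [hcover, Measure.restrict_univ]
    _ ≤ (∫⁻ σ in S₀, ENNReal.ofReal (((‖x₁ - X σ‖ ^ 2 + 1) ^ (3 / 2 : ℝ))⁻¹)) +
          ∫⁻ σ in T, ENNReal.ofReal (((‖x₁ - X σ‖ ^ 2 + 1) ^ (3 / 2 : ℝ))⁻¹) :=
        lintegral_union_le _ _ _
    _ < ⊤ := ENNReal.add_lt_top.2
        ⟨h0.trans_lt ENNReal.ofReal_lt_top, h1.trans_lt ENNReal.ofReal_lt_top⟩

/-- Conjunct 1 of the registered stub: whole-line integrability of
`σ ↦ ((‖x₁ − X σ‖² + 1)^{3/2})⁻¹` from length regularity. [folklore] -/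
private theorem stvc_conj1 :
    ∀ (X : ℝ → EuclideanSpace ℝ (Fin 3)) (x₁ : EuclideanSpace ℝ (Fin 3)) (C₀ D₀ : ℝ),
      Continuous X → 0 ≤ C₀ → 1 ≤ D₀ →
      (∀ D : ℝ, D₀ ≤ D → volume {σ : ℝ | ‖X σ - x₁‖ ≤ D} ≤ ENNReal.ofReal (C₀ * D)) →
      Integrable (fun σ : ℝ => ((‖x₁ - X σ‖ ^ 2 + 1) ^ (3 / 2 : ℝ))⁻¹) :=
  fun _ x₁ _ _ hXc hC₀ hD₀ hlen => stvc_integrable hXc x₁ hC₀ hD₀ hlen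

/-- Conjunct 2 of the registered stub: the far-field tail `{σ | A ≤ ‖X σ − x₁‖}` (`A ≥ D₀`) is
integrable and its (Bochner) integral is `≤ 4 C₀ / A²`. [folklore] -/
private theorem stvc_conj2 :
    ∀ (X : ℝ → EuclideanSpace ℝ (Fin 3)) (x₁ : EuclideanSpace ℝ (Fin 3)) (C₀ D₀ A : ℝ),
      Continuous X → 0 ≤ C₀ → 1 ≤ D₀ → D₀ ≤ A →
      (∀ D : ℝ, D₀ ≤ D → volume {σ : ℝ | ‖X σ - x₁‖ ≤ D} ≤ ENNReal.ofReal (C₀ * D)) →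
      IntegrableOn (fun σ : ℝ => ((‖x₁ - X σ‖ ^ 2 + 1) ^ (3 / 2 : ℝ))⁻¹)
          {σ : ℝ | A ≤ ‖X σ - x₁‖} ∧
        ∫ σ in {σ : ℝ | A ≤ ‖X σ - x₁‖}, ((‖x₁ - X σ‖ ^ 2 + 1) ^ (3 / 2 : ℝ))⁻¹ ≤
          4 * C₀ / A ^ 2 := by
  intro X x₁ C₀ D₀ A hXc hC₀ hD₀ hA hlen
  refine ⟨(stvc_integrable hXc x₁ hC₀ hD₀ hlen).integrableOn, ?_⟩
  have hApos : 0 < A := one_pos.trans_le (hD₀.trans hA)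
  rw [integral_eq_lintegral_of_nonneg_ae (Eventually.of_forall fun σ => stvc_kernel_nonneg _)
    (stvc_continuous_kernel hXc x₁).aestronglyMeasurable]
  exact ENNReal.toReal_le_of_le_ofReal (by positivity) (stvc_tail_lintegral hC₀ hD₀ hA hlen)

/-- **Registered tools stub `stub_tameVerticalToolsC`** (line `zero-accretion-selection`): from
length regularity of a continuous curve `X` at `x₁` (measure `≤ C₀ D` of parameters in every ball
of radius `D ≥ D₀ ≥ 1` around `x₁`), (1) `σ ↦ ((‖x₁ − X σ‖² + 1)^{3/2})⁻¹` is integrable, and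
(2) for `A ≥ D₀` its integral over the far field `{σ | A ≤ ‖X σ − x₁‖}` is `≤ 4 C₀ / A²`.
[folklore] -/
theorem stub_tameVerticalToolsC :
    (∀ (X : ℝ → EuclideanSpace ℝ (Fin 3)) (x₁ : EuclideanSpace ℝ (Fin 3)) (C₀ D₀ : ℝ),
      Continuous X → 0 ≤ C₀ → 1 ≤ D₀ →
      (∀ D : ℝ, D₀ ≤ D → volume {σ : ℝ | ‖X σ - x₁‖ ≤ D} ≤ ENNReal.ofReal (C₀ * D)) →
      Integrable (fun σ : ℝ => ((‖x₁ - X σ‖ ^ 2 + 1) ^ (3 / 2 : ℝ))⁻¹)) ∧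
    (∀ (X : ℝ → EuclideanSpace ℝ (Fin 3)) (x₁ : EuclideanSpace ℝ (Fin 3)) (C₀ D₀ A : ℝ),
      Continuous X → 0 ≤ C₀ → 1 ≤ D₀ → D₀ ≤ A →
      (∀ D : ℝ, D₀ ≤ D → volume {σ : ℝ | ‖X σ - x₁‖ ≤ D} ≤ ENNReal.ofReal (C₀ * D)) →
      IntegrableOn (fun σ : ℝ => ((‖x₁ - X σ‖ ^ 2 + 1) ^ (3 / 2 : ℝ))⁻¹)
          {σ : ℝ | A ≤ ‖X σ - x₁‖} ∧
        ∫ σ in {σ : ℝ | A ≤ ‖X σ - x₁‖}, ((‖x₁ - X σ‖ ^ 2 + 1) ^ (3 / 2 : ℝ))⁻¹ ≤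
          4 * C₀ / A ^ 2) :=
  ⟨stvc_conj1, stvc_conj2⟩

end Summit.NavierStokesRegularity.NavierStokesRegularity.Theorems.SkeletonEquilibrium.ZeroAccretionSelection
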